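import Summits.NavierStokesRegularity.NavierStokesRegularity.Theses.ContinuousAlignment
import Literature.Analysis.FluidPDE.BlowupAncientSolution
import Literature.Analysis.FluidPDE.KNSSTypeIIHolds

/-!
# Line `pace` — crux `ContinuousAlignmentCriterion` (W2, rate-free Constantin–Fefferman / Giga–Miura criterion)
Route `route-NavierStokesRegularity-ContinuousAlignment`, item `stmt-NavierStokesRegularity-18584`
(strategist line; workfile `Cruxes/ContinuousAlignmentCriterion/Lines/pace.lean`, never imported by the tree;
`sorry` only inside the three `stub_*`).

IDEA ("vorticity keeps pace"). The only use of the Type I rate in Giga–Miura 2011 / Giga–Hsu–Maekawa 2014 /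
Giga–Gu–Hsu 2019 / Barker–Prange 2020 is to prevent the KNSS blow-up limit (rescaling by the running velocity
maximum `M(t) = sup_{[0,t]×ℝ³} |u|`) from being a NON-ZERO CONSTANT; a constant limit arises exactly when the
vorticity maximum `Ω(t) = ‖ω(t)‖_∞` is `o(M(t)²)` as `t → T`.  So the crux splits along the scale comparison
`Ω` vs `M²` instead of along a rate:
* `stub_vorticityKeepsPace` (OPEN CORE, the new cut): for a continuously-aligned classical Leray–Hopf solution on
  `[0,T)`, vorticity keeps pace with velocity along a sequence of times — `∃ C, ∀ t₀ < T, ∃ t ∈ [t₀,T),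
  M(t)² ≤ C (1 + Ω(t))` (pointwise form, no `iSup`).  Trivial for bounded solutions (`C = M∞²`); for an unbounded
  one it says `limsup_{t→T} Ω(t)/M(t)² > 0`, i.e. NO VELOCITY-DOMINATED ("infinite local Reynolds number")
  aligned blow-up.  It is an a-priori scale statement with no reference to extension or to ancient solutions.
* `stub_paceZoom` (provable class, L): keeps-pace + unbounded ⇒ the KNSS §6 rescaling `λ_k = 1/M(t_k)` centred at a
  vorticity near-maximiser `y_k` at the pace times `t_k → T` converges in `C^k_loc` (bounded classical solutions
  have interior derivative bounds) to a bounded ancient mild solution `v` (ν = 1 after `u ↦ ν⁻¹u(·/ν)`), smooth with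
  bounded gradient, with `curl v(s,0) ≠ 0` for `s` near `0⁻` (pace: `|curl v_k(0,0)| ≥ 1/(2C) > 0`), hence NOT
  spatially constant; continuous alignment at the fixed physical scale `δ(ε)` and threshold `d ≪ M_k²` makes all
  non-zero vorticity vectors of each slice `v(s,·)` parallel (±) to one line `ℓ(s)`; the line is frozen in time on
  the component `(a,0)` of `{s : curl v(s) ≢ 0}` (differentiate `ω = w e(s)`: the vorticity equation of a field
  invariant along `e(s)` has range `∥ e(s)`, so `w ė = 0`), and `a = −∞` because `v(a,·)` would be spatially
  constant and bounded mild solutions from constant data stay constant (KNSS 2009 §4 / Giga–Inui–Matsui L∞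
  uniqueness), contradicting `curl v(s,0) ≠ 0` near `0`.  No `sup |v| = 1` normalisation is required (the
  Liouville stub does not need it), so no renormalisation step.
* `stub_unidirectionalLiouville` (provable now, M; VERBATIM the shared item `stmt-NavierStokesRegularity-1923` of
  route DirectionDissipationQuantum, cf. the in-tree Type-I version
  `Theorems.unidirectionalVorticityLiouville`): planar descent + in-tree `KNSS2009_liouville_planar_holds`.
SKELETON `ContinuousAlignmentCriterion_of`: get `C` from keeps-pace; if `u` is bounded on `[0,T)` the PROVED
continuation theorem `Literature.Analysis.FluidPDE.hasSmoothExtensionPast_of_bounded_holds` (RRS 2016 Thm 8.17)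
gives the extension; otherwise `stub_paceZoom` yields a non-constant unidirectional bounded ancient `v`, which
`stub_unidirectionalLiouville` makes spatially constant — contradiction.  Kernel-checked, `sorry` only in stubs.

WHY IT DODGES the birth line's open half (`Birth.stub_velocityDominated : aligned ∧ ¬VD ⇒ extension`, VD = pace at
ALL times): (i) solutions that are vorticity-dominated only along a sequence of times move from the open half to
the provable half; (ii) the open core no longer mentions extension/blow-up — it is a pure comparison of two
suprema, refutable on explicit flows and attackable by max-point / pressure-gradient differential inequalities
(`d⁺M²/dt ≤ 2M‖∇p‖_∞`); (iii) the zoom stub receives `u` unbounded (not `¬HasSmoothExtensionPast`) and delivers the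
un-normalised class the Liouville stub actually consumes.
-/

namespace Summit.NavierStokesRegularity.NavierStokesRegularity.Cruxes.ContinuousAlignmentCriterion.Pace

open Summit.NavierStokesRegularity.NavierStokesRegularity.Theses.ContinuousAlignment

/-- STUB 1 — PACE ZOOM (KNSS2009 §6 rescaling by the running velocity maximum at the pace times, centred at a
vorticity near-maximiser; C^k_loc compactness of bounded classical solutions; continuous alignment ⇒ slice-wise
unidirectional limit vorticity; direction frozen in time; non-constancy from `|curl v_k(0,0)| ≥ 1/(2C)`).
GigaMiura2011 / GigaHsuMaekawa2014 Thm 1.2 (arXiv:1310.6471 p.16 Step 3) with the Type I rate replaced by the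
pace hypothesis; KNSS2009 Prop 6.1 (arXiv:0709.3599 p.11). -/
theorem stub_paceZoom : ∀ (ν T : ℝ), 0 < ν → 0 < T → ∀ (u : ℝ → EuclideanSpace ℝ (Fin 3) → EuclideanSpace ℝ (Fin 3)) (p : ℝ → EuclideanSpace ℝ (Fin 3) → ℝ), Literature.Analysis.FluidPDE.IsClassicalNSSolutionOn (Set.Ico 0 T) ν 0 u p → Literature.Analysis.FluidPDE.IsLerayHopfOn T ν 0 (u 0) u → Literature.Analysis.FluidPDE.HasRapidSpatialDecay (u 0) → ∀ d : ℝ, 0 < d → (∀ ε : ℝ, 0 < ε → ∃ δ : ℝ, 0 < δ ∧ ∀ t ∈ Set.Ico 0 T, ∀ x y : EuclideanSpace ℝ (Fin 3), d < ‖Literature.Analysis.FluidPDE.curl (u t) x‖ → d < ‖Literature.Analysis.FluidPDE.curl (u t) y‖ → ‖x - y‖ < δ → Real.sqrt (1 - (inner ℝ (‖Literature.Analysis.FluidPDE.curl (u t) x‖⁻¹ • Literature.Analysis.FluidPDE.curl (u t) x) (‖Literature.Analysis.FluidPDE.curl (u t) y‖⁻¹ • Literature.Analysis.FluidPDE.curl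 (u t) y)) ^ 2) ≤ ε) → (∃ C : ℝ, ∀ t₀ ∈ Set.Ico 0 T, ∃ t ∈ Set.Ico t₀ T, ∀ s ∈ Set.Icc 0 t, ∀ x : EuclideanSpace ℝ (Fin 3), ∃ y : EuclideanSpace ℝ (Fin 3), ‖u s x‖ ^ 2 ≤ C * (1 + ‖Literature.Analysis.FluidPDE.curl (u t) y‖)) → (¬ ∃ M : ℝ, ∀ t ∈ Set.Ico 0 T, ∀ x : EuclideanSpace ℝ (Fin 3), ‖u t x‖ ≤ M) → ∃ (v : ℝ → EuclideanSpace ℝ (Fin 3) → EuclideanSpace ℝ (Fin 3)) (e : EuclideanSpace ℝ (Fin 3)), ‖e‖ = 1 ∧ Literature.Analysis.FluidPDE.IsBoundedAncientMildSolution 1 v ∧ ContDiffOn ℝ (⊤ : ℕ∞) (Function.uncurry v) (Set.Iio 0 ×ˢ Set.univ) ∧ (∃ C : ℝ, ∀ t < 0, ∀ x, ‖fderiv ℝ (v t) x‖ ≤ C) ∧ (∀ t < 0, ∀ x, ∃ c : ℝ, Literature.Analysis.FluidPDE.curl (v t) x = c • e) ∧ ¬ (∀ t < 0, ∀ x y,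 v t x = v t y) := by
  sorry

/-- STUB 2 — UNIDIRECTIONAL ANCIENT LIOUVILLE (verbatim the shared open item stmt-NavierStokesRegularity-1923 of
route DirectionDissipationQuantum: planar descent + the in-tree KNSS 2D Liouville theorem
`KNSS2009_liouville_planar_holds`; Type-I analogue proved in tree as `Theorems.unidirectionalVorticityLiouville`). -/
theorem stub_unidirectionalLiouville : ∀ (v : ℝ → EuclideanSpace ℝ (Fin 3) → EuclideanSpace ℝ (Fin 3)) (e : EuclideanSpace ℝ (Fin 3)), ‖e‖ = 1 → Literature.Analysis.FluidPDE.IsBoundedAncientMildSolution 1 v → ContDiffOn ℝ (⊤ : ℕ∞) (Function.uncurry v) (Set.Iio 0 ×ˢ Set.univ) → (∃ C : ℝ, ∀ t < 0, ∀ x, ‖fderiv ℝ (v t) x‖ ≤ C) → (∀ t < 0, ∀ x, ∃ c : ℝ, Literature.Analysis.FluidPDE.curl (v t) x = c • e) → ∀ t < 0, ∀ x y, v t x = v t y := by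
  sorry

/-- STUB 3 — VORTICITY KEEPS PACE WITH VELOCITY (the OPEN CORE of this line): for a continuously aligned classical
Leray–Hopf solution on `[0,T)` there is `C` such that for times `t` arbitrarily close to `T` the running velocity
maximum obeys `sup_{[0,t]×ℝ³} |u|² ≤ C (1 + sup_y |ω(t,y)|)` — no velocity-dominated (local-Reynolds-number → ∞)
aligned blow-up.  Trivially true for bounded solutions; the content is at a blow-up time, where it is exactly the
non-constancy of the KNSS velocity-scale limit that Type I supplied in GigaMiura2011 / GigaGuHsu2019 p.7 /
BarkerPrange2020 (arXiv:1906.08225 p.8).  Why it might fail: a Type II aligned blow-up with a coherent fast jet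
(|u| ≈ M on a parabolic ball of radius ≫ 1/M) and vorticity o(M²) is not excluded by any known estimate. -/
theorem stub_vorticityKeepsPace : ∀ (ν T : ℝ), 0 < ν → 0 < T → ∀ (u : ℝ → EuclideanSpace ℝ (Fin 3) → EuclideanSpace ℝ (Fin 3)) (p : ℝ → EuclideanSpace ℝ (Fin 3) → ℝ), Literature.Analysis.FluidPDE.IsClassicalNSSolutionOn (Set.Ico 0 T) ν 0 u p → Literature.Analysis.FluidPDE.IsLerayHopfOn T ν 0 (u 0) u → Literature.Analysis.FluidPDE.HasRapidSpatialDecay (u 0) → ∀ d : ℝ, 0 < d → (∀ ε : ℝ, 0 < ε → ∃ δ : ℝ, 0 < δ ∧ ∀ t ∈ Set.Ico 0 T, ∀ x y : EuclideanSpace ℝ (Fin 3), d < ‖Literature.Analysis.FluidPDE.curl (u t) x‖ → d < ‖Literature.Analysis.FluidPDE.curl (u t) y‖ → ‖x - y‖ < δ → Real.sqrt (1 - (inner ℝ (‖Literature.Analysis.FluidPDE.curl (u t) x‖⁻¹ • Literature.Analysis.FluidPDE.curl (u t) x) (‖Literature.Analysis.FluidPDE.curl (u t) y‖⁻¹ •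 Literature.Analysis.FluidPDE.curl (u t) y)) ^ 2) ≤ ε) → ∃ C : ℝ, ∀ t₀ ∈ Set.Ico 0 T, ∃ t ∈ Set.Ico t₀ T, ∀ s ∈ Set.Icc 0 t, ∀ x : EuclideanSpace ℝ (Fin 3), ∃ y : EuclideanSpace ℝ (Fin 3), ‖u s x‖ ^ 2 ≤ C * (1 + ‖Literature.Analysis.FluidPDE.curl (u t) y‖) := by
  sorry

/-- SKELETON THEOREM (kernel-checked; no `sorry` here — only inside the three stubs it invokes by name): the route
crux BY NAME.  `stub_vorticityKeepsPace` gives the pace constant; a bounded solution extends by the PROVED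
continuation theorem `hasSmoothExtensionPast_of_bounded_holds` (RobinsonRodrigoSadowski2016 Thm 8.17); an unbounded
one zooms (`stub_paceZoom`) to a non-constant unidirectional bounded ancient mild solution, which
`stub_unidirectionalLiouville` makes spatially constant — contradiction. -/
theorem ContinuousAlignmentCriterion_of : ContinuousAlignmentCriterion := by
  intro ν T hν hT u p hcl hLH hdec d hd hal
  have hpace := stub_vorticityKeepsPace ν T hν hT u p hcl hLH hdec d hd hal
  by_cases hbd : ∃ M : ℝ, ∀ t ∈ Set.Ico 0 T, ∀ x : EuclideanSpace ℝ (Fin 3), ‖u t x‖ ≤ M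
  · have hext := Literature.Analysis.FluidPDE.hasSmoothExtensionPast_of_bounded_holds
    exact hext hν hT hcl hLH hbd
  · obtain ⟨v, e, he, hv, hsm, hgrad, hdir, hnc⟩ :=
      stub_paceZoom ν T hν hT u p hcl hLH hdec d hd hal hpace hbd
    exact (hnc (stub_unidirectionalLiouville v e he hv hsm hgrad hdir)).elim

end Summit.NavierStokesRegularity.NavierStokesRegularity.Cruxes.ContinuousAlignmentCriterion.Pace
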